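import Summits.KontsevichZagierPeriods.KontsevichZagierPeriods.Theses.GaussManinCertificates
import Literature.NumberTheory.Transcendental.KZLogCalculus
import Literature.NumberTheory.Transcendental.KZSemiCanonicalReductionProofs

/-!
# Line `runs_and_bands` for crux `KZStokes` (stmt-KontsevichZagierPeriods-3012, route GaussManinCertificates)

Crux strategist's TYPED DECOMPOSITION of `KZStokes` (BC2 redirect), registered as a skeleton line:
two stubs — the two pieces, each a genuine lemma and neither a restatement of the crux or of the
summit (probes `piece → KZStokes`, `piece → KontsevichZagierPeriods` by `exact? | simpa | aesop` fail,
`Cruxes/KZStokes/SPLIT.md`) — and the kernel-checked composition `KZStokes_of`.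

* `stub_semialgebraicFibreRuns` (= piece `SemialgebraicFibreRuns`, real algebraic geometry, size M):
  a bounded `ℚ`-semialgebraic `σ ⊆ ℝⁿ⁺¹` is, off a null set, the disjoint union of finitely many open
  run bands `{(x,t) | x ∈ S_j, a_j x < t < b_j x}` (`S_j`, `a_j < b_j` `ℚ`-semialgebraic) whose fibres lie
  in `σ_x` with both end points on `frontier σ_x` — maximal runs of the PROVED adapted CAD
  (`Literature.ModelTheory.ExponentialFields.IsSemialgebraic.exists_cylindricalDecomposition_holds`,
  `….exists_cylindricalDecomposition.exists_fibre_eq`).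
* `stub_kzStokesBand` (= piece `KZStokesBand`, calculus of moves, size S): Newton–Leibniz on one open
  band with a primitive vanishing at both ends (band form of the proved `KZStokesBox`,
  `Theorems/GaussManinCertificatesKZStokesBox.lean`).
* `KZStokes_of_subs` : stub₁ → stub₂ → `KZStokes` (and `KZStokes_of : KZStokes` from the two stubs) — iterated domain additivity over the runs
  (`KZ.of_sub_sum_of_mem_relations`) + transport of the fibrewise hypotheses of `KZStokes` to each run.
  The same proof, with the stubs as hypotheses, is the Theorems candidate
  `GaussManinCertificatesKZStokesSplit.lean` (evidence on stmt-3012).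

Disproof used: none relevant (no `Disproof.lean` for this crux). Dead lines: none registered.
-/

noncomputable section

open MeasureTheory Set Filter Topology
open Literature.ModelTheory.ExponentialFields (IsSemialgebraic)
open Literature.NumberTheory.Transcendental

-- `Summit.KontsevichZagierPeriods.KontsevichZagierPeriods.…` is the tree's mandated layout (single-conjunct summit).
set_option linter.dupNamespace false

namespace Summit.KontsevichZagierPeriods.KontsevichZagierPeriods.Cruxes.KZStokes.RunsAndBands

/-- STUB 1 (piece `SemialgebraicFibreRuns`): fibre-run decomposition of a bounded `ℚ`-semialgebraic
set — maximal vertical runs of the adapted cylindrical decomposition. [cite: BasuPollackRoy2006, Cor. 5.7] -/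
theorem stub_semialgebraicFibreRuns :
    ∀ (n : ℕ) (σ : Set (Fin (n + 1) → ℝ)), Literature.ModelTheory.ExponentialFields.IsSemialgebraic ℚ σ → Bornology.IsBounded σ → ∃ (J : ℕ) (S : Fin J → Set (Fin n → ℝ)) (a b : Fin J → (Fin n → ℝ) → ℝ) (R : Fin J → Set (Fin (n + 1) → ℝ)), (∀ j, Literature.ModelTheory.ExponentialFields.IsSemialgebraic ℚ (S j)) ∧ (∀ j, Literature.NumberTheory.Transcendental.IsSemialgebraicFunOn ℚ (S j) (a j)) ∧ (∀ j, Literature.NumberTheory.Transcendental.IsSemialgebraicFunOn ℚ (S j) (b j)) ∧ (∀ j, ∀ x ∈ S j, a j x < b j x) ∧ (∀ j, R j = {z : Fin (n + 1) → ℝ | Fin.init z ∈ S j ∧ z (Fin.last n) ∈ Set.Ioo (a j (Fin.init z)) (b j (Fin.init z))}) ∧ (∀ j, Literature.ModelTheory.ExponentialFields.IsSemialgebraic ℚ (R j)) ∧ (∀ j, ∀ x ∈ S j, Set.Ioo (a j x) (b j x) ⊆ {s : ℝ | (Fin.snoc x s : Fin (n + 1) → ℝ) ∈ σ}) ∧ (∀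 j, ∀ x ∈ S j, a j x ∈ frontier {s : ℝ | (Fin.snoc x s : Fin (n + 1) → ℝ) ∈ σ} ∧ b j x ∈ frontier {s : ℝ | (Fin.snoc x s : Fin (n + 1) → ℝ) ∈ σ}) ∧ (Pairwise fun i j => Disjoint (R i) (R j)) ∧ MeasureTheory.volume (σ \ ⋃ j, R j) = 0 := by
  sorry

/-- STUB 2 (piece `KZStokesBand`): Newton–Leibniz on one open band with vanishing boundary values
(band form of `KZStokesBox`). [Kontsevich–Zagier 2001, §1.2, rules 1) and 3)] -/
theorem stub_kzStokesBand :
    ∀ (n : ℕ) (S : Set (Fin n → ℝ)) (a b : (Fin n → ℝ) → ℝ) (r : Literature.NumberTheory.Transcendental.KZ.IntegralRep (n + 1)) (H : (Fin (n + 1) → ℝ) → ℝ), Literature.ModelTheory.ExponentialFields.IsSemialgebraic ℚ S → Literature.NumberTheory.Transcendental.IsSemialgebraicFunOn ℚ S a → Literature.NumberTheory.Transcendental.IsSemialgebraicFunOn ℚ S b → (∀ x ∈ S, a x < b x) → r.domain = {z : Fin (n + 1) → ℝ | Fin.init z ∈ S ∧ z (Fin.last n) ∈ Set.Ioo (a (Fin.init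 z)) (b (Fin.init z))} → Literature.NumberTheory.Transcendental.IsSemialgebraicFunOn ℚ {z : Fin (n + 1) → ℝ | Fin.init z ∈ S ∧ z (Fin.last n) ∈ Set.Icc (a (Fin.init z)) (b (Fin.init z))} H → (∀ x ∈ S, ContinuousOn (fun s : ℝ => H (Fin.snoc x s)) (Set.Icc (a x) (b x)) ∧ H (Fin.snoc x (a x)) = 0 ∧ H (Fin.snoc x (b x)) = 0 ∧ ∀ t ∈ Set.Ioo (a x) (b x), HasDerivAt (fun s : ℝ => H (Fin.snoc x s)) (r.integrand (Fin.snoc x t)) t) → Literature.NumberTheory.Transcendental.KZ.of r ∈ Literature.NumberTheory.Transcendental.KZ.relations := by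
  sorry

/-- A point `(x, t)` whose last coordinate lies in the closure of the vertical fibre
`σ_x = {s | (x, s) ∈ σ}` lies in the closure of `σ` (continuity of `s ↦ (x, s)`). [folklore] -/
theorem snoc_mem_closure_of_mem_closure_fibre {n : ℕ} {σ : Set (Fin (n + 1) → ℝ)}
    {x : Fin n → ℝ} {t : ℝ} (ht : t ∈ closure {s : ℝ | (Fin.snoc x s : Fin (n + 1) → ℝ) ∈ σ}) :
    (Fin.snoc x t : Fin (n + 1) → ℝ) ∈ closure σ := by
  have hc : Continuous fun s : ℝ => (Fin.snoc x s : Fin (n + 1) → ℝ) :=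
    Continuous.finSnoc (A := fun _ : Fin (n + 1) => ℝ) continuous_const continuous_id
  exact hc.closure_preimage_subset σ ht

/-- If the open interval `(a, b)` (`a < b`) lies in the vertical fibre `σ_x`, then the closed
interval `[a, b]` lies in its closure. [folklore] -/
theorem Icc_subset_closure_fibre {n : ℕ} {σ : Set (Fin (n + 1) → ℝ)} {x : Fin n → ℝ} {a b : ℝ}
    (hab : a < b) (hsub : Ioo a b ⊆ {s : ℝ | (Fin.snoc x s : Fin (n + 1) → ℝ) ∈ σ}) :
    Icc a b ⊆ closure {s : ℝ | (Fin.snoc x s : Fin (n + 1) → ℝ) ∈ σ} := by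
  rw [← closure_Ioo hab.ne]
  exact closure_mono hsub

/-- The closed band `{(x, t) | x ∈ S, a x ≤ t ≤ b x}` over a `ℚ`-semialgebraic base with
`ℚ`-semialgebraic edges is `ℚ`-semialgebraic (`KZlog.isSemialgebraic_band`, fibres written with
`Set.Icc`). [folklore] -/
theorem isSemialgebraic_closedBand {n : ℕ} {S : Set (Fin n → ℝ)} {a b : (Fin n → ℝ) → ℝ}
    (ha : IsSemialgebraicFunOn ℚ S a) (hb : IsSemialgebraicFunOn ℚ S b) :
    IsSemialgebraic ℚ {z : Fin (n + 1) → ℝ | Fin.init z ∈ S ∧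
      z (Fin.last n) ∈ Icc (a (Fin.init z)) (b (Fin.init z))} := by
  have h := KZlog.isSemialgebraic_band ha hb
  have hEq : {z : Fin (n + 1) → ℝ | Fin.init z ∈ S ∧
      z (Fin.last n) ∈ Icc (a (Fin.init z)) (b (Fin.init z))} = KZlog.band S a b := by
    ext z
    simp only [mem_setOf_eq, mem_Icc, KZlog.mem_band]
  rw [hEq]
  exact h

/-- **Composition**: the two stubs imply the crux `KZStokes` (cut `[r]` along the runs by iterated
domain additivity, apply the band move to each run with the primitive `H` of `KZStokes`).
[Kontsevich–Zagier 2001, §1.2, rules 1) and 3); Basu–Pollack–Roy 2006, Cor. 5.7] -/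
theorem KZStokes_of_subs
    (hA : ∀ (n : ℕ) (σ : Set (Fin (n + 1) → ℝ)), Literature.ModelTheory.ExponentialFields.IsSemialgebraic ℚ σ → Bornology.IsBounded σ → ∃ (J : ℕ) (S : Fin J → Set (Fin n → ℝ)) (a b : Fin J → (Fin n → ℝ) → ℝ) (R : Fin J → Set (Fin (n + 1) → ℝ)), (∀ j, Literature.ModelTheory.ExponentialFields.IsSemialgebraic ℚ (S j)) ∧ (∀ j, Literature.NumberTheory.Transcendental.IsSemialgebraicFunOn ℚ (S j) (a j)) ∧ (∀ j, Literature.NumberTheory.Transcendental.IsSemialgebraicFunOn ℚ (S j) (b j)) ∧ (∀ j, ∀ x ∈ S j, a j x < b j x) ∧ (∀ j, R j = {z : Fin (n + 1) → ℝ | Fin.init z ∈ S j ∧ z (Fin.last n) ∈ Set.Ioo (a j (Fin.init z)) (b j (Fin.init z))}) ∧ (∀ j, Literature.ModelTheory.ExponentialFields.IsSemialgebraic ℚ (R j)) ∧ (∀ j, ∀ x ∈ S j, Set.Ioo (a j x) (b j x) ⊆ {s : ℝ | (Fin.snoc x s : Fin (n + 1) → ℝ) ∈ σ}) ∧ (∀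 j, ∀ x ∈ S j, a j x ∈ frontier {s : ℝ | (Fin.snoc x s : Fin (n + 1) → ℝ) ∈ σ} ∧ b j x ∈ frontier {s : ℝ | (Fin.snoc x s : Fin (n + 1) → ℝ) ∈ σ}) ∧ (Pairwise fun i j => Disjoint (R i) (R j)) ∧ MeasureTheory.volume (σ \ ⋃ j, R j) = 0)
    (hB : ∀ (n : ℕ) (S : Set (Fin n → ℝ)) (a b : (Fin n → ℝ) → ℝ) (r : Literature.NumberTheory.Transcendental.KZ.IntegralRep (n + 1)) (H : (Fin (n + 1) → ℝ) → ℝ), Literature.ModelTheory.ExponentialFields.IsSemialgebraic ℚ S → Literature.NumberTheory.Transcendental.IsSemialgebraicFunOn ℚ S a → Literature.NumberTheory.Transcendental.IsSemialgebraicFunOn ℚ S b → (∀ x ∈ S, a x < b x) → r.domain = {z : Fin (n + 1) → ℝ | Fin.init z ∈ S ∧ z (Fin.last n) ∈ Set.Ioo (a (Fin.init z)) (b (Fin.init z))} → Literature.NumberTheory.Transcendental.IsSemialgebraicFunOn ℚ {z : Fin (n + 1) → ℝ | Fin.init z ∈ S ∧ z (Fin.last n) ∈ Set.Icc (a (Fin.init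 z)) (b (Fin.init z))} H → (∀ x ∈ S, ContinuousOn (fun s : ℝ => H (Fin.snoc x s)) (Set.Icc (a x) (b x)) ∧ H (Fin.snoc x (a x)) = 0 ∧ H (Fin.snoc x (b x)) = 0 ∧ ∀ t ∈ Set.Ioo (a x) (b x), HasDerivAt (fun s : ℝ => H (Fin.snoc x s)) (r.integrand (Fin.snoc x t)) t) → Literature.NumberTheory.Transcendental.KZ.of r ∈ Literature.NumberTheory.Transcendental.KZ.relations) :
    Summit.KontsevichZagierPeriods.KontsevichZagierPeriods.Theses.GaussManinCertificates.KZStokes := by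
  intro n r H hbdd hH hcont hfr hder
  obtain ⟨J, S, a, b, R, hS, ha, hb, hab, hR, hRsa, hsub, hfrab, hdisj, hnull⟩ :=
    hA n r.domain r.isSemialgebraic_domain hbdd
  -- fibrewise membership in a run
  have hmemR : ∀ (j : Fin J) (x : Fin n → ℝ) (t : ℝ), (Fin.snoc x t : Fin (n + 1) → ℝ) ∈ R j ↔
      x ∈ S j ∧ t ∈ Ioo (a j x) (b j x) := fun j x t => by
    rw [hR j]
    simp only [mem_setOf_eq, Fin.init_snoc, Fin.snoc_last]
  -- the runs lie in `σ = r.domain`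
  have hRσ : ∀ j, R j ⊆ r.domain := fun j z hz => by
    have hz' : (Fin.snoc (Fin.init z) (z (Fin.last n)) : Fin (n + 1) → ℝ) ∈ R j := by
      rwa [Fin.snoc_init_self]
    obtain ⟨hx, ht⟩ := (hmemR j _ _).1 hz'
    have h := hsub j _ hx ht
    rwa [mem_setOf_eq, Fin.snoc_init_self] at h
  -- the representations `[R_j, r.integrand]`
  set ρ : Fin J → KZ.IntegralRep (n + 1) := fun j => r.restrict (R j) (hRsa j) (hRσ j) with hρ_def
  have hρd : ∀ j, (ρ j).domain = R j := fun j => rfl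
  -- iterated domain additivity over the almost-partition of `σ` by the runs
  have hsum : KZ.of r - ∑ j ∈ (Finset.univ : Finset (Fin J)), KZ.of (ρ j) ∈ KZ.relations := by
    refine KZ.of_sub_sum_of_mem_relations Finset.univ r ρ (fun j _ => ?_)
      (fun j _ => fun z _ => rfl) ?_ ?_
    · rw [hρd, sdiff_eq_empty.mpr (hRσ j), measure_empty]
    · have h1 : (⋃ j ∈ (Finset.univ : Finset (Fin J)), (ρ j).domain) = ⋃ j, R j := by
        simp only [Finset.mem_univ, iUnion_true, hρd]
      rw [h1]
      exact hnull
    · intro i _ j _ hij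
      rw [hρd, hρd, disjoint_iff_inter_eq_empty.mp (hdisj hij), measure_empty]
  -- each run is a relation: the open-band move with the primitive `H`
  have hρ : ∀ j, KZ.of (ρ j) ∈ KZ.relations := by
    intro j
    have hIcc : ∀ x ∈ S j, Icc (a j x) (b j x) ⊆
        closure {s : ℝ | (Fin.snoc x s : Fin (n + 1) → ℝ) ∈ r.domain} := fun x hx =>
      Icc_subset_closure_fibre (hab j x hx) (hsub j x hx)
    have hband : {z : Fin (n + 1) → ℝ | Fin.init z ∈ S j ∧
        z (Fin.last n) ∈ Icc (a j (Fin.init z)) (b j (Fin.init z))} ⊆ closure r.domain := by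
      intro z hz
      have h1 := hIcc (Fin.init z) hz.1 hz.2
      have h2 := snoc_mem_closure_of_mem_closure_fibre h1
      rwa [Fin.snoc_init_self] at h2
    have hbandsa := isSemialgebraic_closedBand (n := n) (ha j) (hb j)
    exact hB n (S j) (a j) (b j) (ρ j) H (hS j) (ha j) (hb j) (hab j) ((hρd j).trans (hR j))
      (hH.mono hband hbandsa) fun x hx =>
        ⟨(hcont x).mono (hIcc x hx), hfr x _ (hfrab j x hx).1, hfr x _ (hfrab j x hx).2,
          fun t ht => hder x t (interior_maximal (hsub j x hx) isOpen_Ioo ht)⟩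
  have heq : KZ.of r = (KZ.of r - ∑ j ∈ (Finset.univ : Finset (Fin J)), KZ.of (ρ j)) +
      ∑ j ∈ (Finset.univ : Finset (Fin J)), KZ.of (ρ j) := by
    abel
  rw [heq]
  exact add_mem hsum (sum_mem fun j _ => hρ j)


/-- **The crux from the two registered stubs.** [Kontsevich–Zagier 2001, §1.2, rules 1) and 3)] -/
theorem KZStokes_of :
    Summit.KontsevichZagierPeriods.KontsevichZagierPeriods.Theses.GaussManinCertificates.KZStokes :=
  KZStokes_of_subs stub_semialgebraicFibreRuns stub_kzStokesBand

end Summit.KontsevichZagierPeriods.KontsevichZagierPeriods.Cruxes.KZStokes.RunsAndBands
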